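import Literature.Probability.FitznerVanDerHofstad2017.NobleBoundsNReal
import Literature.Probability.FitznerVanDerHofstad2017.NobleBoundsN1IotaAvg
import HarnessLib

/-!
# [FvdH17] Prop. 5.6 (5.37) → the real per-`N` bounds `hN` of `NobleNSums` for `Ξ^{(N),ι}` (X2-ι / X2-sum glue)

R. Fitzner and R. van der Hofstad, *Mean-field behavior for nearest-neighbor percolation in `d > 10`*,
Electron. J. Probab. **22** (2017) no. 43; arXiv:1506.07977v2 — Remark 2.3 (pp. 12–13), §5.1 "Elements of the
bounds" (p. 49: `(P⃗^ι)_b = (1/2d)[δ_{0,b} + Σ_{ι,x,y} P^{ι,b}(x,y)]`), Prop. 5.6 (5.37) (p. 53), §6.1 (p. 59),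
§3.5 (symmetry, p. 30), §5.4 (p. 56).

## What this module is

The `ι`-start companion of `NobleBoundsNReal`: bookkeeping, kernel-checked, nothing cited as a fact, no number.
The `N ≥ 2` `ι`-chain assembly (`NobleBoundsNAssembly.invTwoD_mul_sum_tsum_le_of_cover`) concludes, for a family
`Ξ^ι`, `(1/2d) Σ_ι Σ_x Ξ^ι(x) ≤ P⃗^ι ᵥ* (B^n * Ā) ⬝ᵥ P⃗^E` in `[0, ∞]`; the record consumes, per fixed direction
`ι₀`, `Summable (Ξ^{(N),ι₀}) ∧ Σ_x Ξ^{(N),ι₀}(x) ≤ u ⬝ᵥ ((B^{N−1} * A) *ᵥ w)` over real majorants.  Provided: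
* `le_of_invTwoD_mul_sum_le` — removing the `ι`-average under symmetry (`(1/2d) Σ_ι s_ι ≤ c`, `s_ι = s_{ι₀}` ⟹
  `s_{ι₀} ≤ c`);
* `summable_and_tsum_le_of_chain_majorants_ofReal` — the majorant bridge in `ofReal`-currency for a non-negative
  real family;
* `invTwoD_mul_sum_tsum_ofReal_le_of_T` — currency change `ofReal ∘ nobleXiIotaN ≤ nobleXiIotaT` under the average;
* `nobleXiIotaN_summable_and_tsum_le_of_chain` (one `N = n + 1`, fixed `ι₀`, from the averaged `[0,∞]` chain bound
  on `nobleXiIotaT`), `nobleXiIotaN_hN_of_chain` (literally the `hN` shape of `NobleNSums.NSumLE_rows_of_bounds` for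
  `Ξ N = nobleXiIotaN d p (e ι₀) N`, from chain bounds at every `n ≥ 3`), `nobleXiIotaN_perN_of_chain` (`n ≥ 1`).
ADDITIVE module; `d`-generic.
-/

noncomputable section

open scoped BigOperators ENNReal Matrix

namespace Literature.Probability.FitznerVanDerHofstad2017.BlockSummation

variable {m : Type*} [Fintype m] [DecidableEq m]

/-- **Majorant bridge in `ofReal`-currency.** For a non-negative real family `Ξ` with
`Σ_x ofReal (Ξ x) ≤ v ᵥ* P^M ᵥ* Q ⬝ᵥ y` and entrywise real majorants with non-negative entries: `Ξ` is summable and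
`Σ_x Ξ x ≤ uℝ ⬝ᵥ ((Bℝ^M * Aℝ) *ᵥ wℝ)`. [cite: FitznerVanDerHofstad2017, Remark 2.3 (arXiv:1506.07977v2 pp. 12–13); §5.4 (p. 56)] -/
theorem summable_and_tsum_le_of_chain_majorants_ofReal {α : Type*} {Ξ : α → ℝ} (h0 : ∀ x, 0 ≤ Ξ x)
    {v y : m → ℝ≥0∞} {P Q : Matrix m m ℝ≥0∞} {uR wR : m → ℝ} {BR AR : Matrix m m ℝ}
    (hu0 : ∀ a, 0 ≤ uR a) (hw0 : ∀ b, 0 ≤ wR b) (hB0 : ∀ a b, 0 ≤ BR a b) (hA0 : ∀ a b, 0 ≤ AR a b)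
    (hu : ∀ a, v a ≤ ENNReal.ofReal (uR a)) (hw : ∀ b, y b ≤ ENNReal.ofReal (wR b))
    (hB : ∀ a b, P a b ≤ ENNReal.ofReal (BR a b)) (hA : ∀ a b, Q a b ≤ ENNReal.ofReal (AR a b)) (M : ℕ)
    (h : ∑' x, ENNReal.ofReal (Ξ x) ≤ v ᵥ* P ^ M ᵥ* Q ⬝ᵥ y) :
    Summable Ξ ∧ ∑' x, Ξ x ≤ uR ⬝ᵥ ((BR ^ M * AR) *ᵥ wR) := by
  have e : (fun x => (ENNReal.ofReal (Ξ x)).toReal) = Ξ := funext fun x => ENNReal.toReal_ofReal (h0 x)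
  have := summable_toReal_and_tsum_le_of_chain_majorants (Ξ := fun x => ENNReal.ofReal (Ξ x))
    hu0 hw0 hB0 hA0 hu hw hB hA M h
  rwa [e] at this

end Literature.Probability.FitznerVanDerHofstad2017.BlockSummation

namespace Literature.Probability.FitznerVanDerHofstad2017.NobleBlocks

open Literature.Probability.LatticeModels Literature.Probability.Percolation
open Literature.Barriers.CriticalPhenomena
open Literature.Probability.FitznerVanDerHofstad2017.BlockSummation

variable {d : ℕ}

/-- **Removing the `ι`-average under symmetry**: `(1/2d) Σ_ι s_ι ≤ c` and `s_ι = s_{ι₀}` for all `ι` give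
`s_{ι₀} ≤ c` (`d ≠ 0`). [cite: FitznerVanDerHofstad2017, §5.1 "Elements of the bounds" (arXiv:1506.07977v2 p. 49); §3.5 (p. 30)] -/
theorem le_of_invTwoD_mul_sum_le (hd : d ≠ 0) {s : Fin d × Bool → ℝ≥0∞} {c : ℝ≥0∞}
    (h : invTwoD d * ∑ ι, s ι ≤ c) (ι₀ : Fin d × Bool) (hsym : ∀ ι, s ι = s ι₀) : s ι₀ ≤ c := by
  simp_rw [hsym, Finset.sum_const, Finset.card_univ, nsmul_eq_mul] at h
  rwa [invTwoD_mul_card_mul hd] at h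

/-- **Currency change under the average**: `(1/2d) Σ_ι Σ_x ofReal (Ξ^{(N),ι}(x)) ≤ (1/2d) Σ_ι Σ_x Ξ^{(N),ι}_T(x)`
(`ofReal ∘ toReal ≤ id`). [folklore] -/
theorem invTwoD_mul_sum_tsum_ofReal_le_of_T (p : unitInterval) (N : ℕ) {c : ℝ≥0∞}
    (h : invTwoD d * ∑ ι : Fin d × Bool, ∑' x, nobleXiIotaT d p (stepVec ι) N x ≤ c) :
    invTwoD d * ∑ ι : Fin d × Bool, ∑' x, ENNReal.ofReal (nobleXiIotaN d p (stepVec ι) N x) ≤ c := by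
  refine le_trans ?_ h
  gcongr with ι _ x
  exact ENNReal.ofReal_toReal_le

/-- **One `N = n + 1`, fixed direction `ι₀`.** From the averaged `[0, ∞]` chain bound
`(1/2d) Σ_ι Σ_x Ξ^{(n+1),ι}_T(x) ≤ v ᵥ* (P^n * Q) ⬝ᵥ y` (the conclusion shape of
`NobleBoundsNAssembly.invTwoD_mul_sum_tsum_le_of_cover`) and entrywise real majorants with non-negative entries:
`nobleXiIotaN d p (e ι₀) (n+1)` is summable and `Σ_x Ξ^{(n+1),ι₀}(x) ≤ uℝ ⬝ᵥ ((Bℝ^n * Aℝ) *ᵥ wℝ)` (the `ι`-average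
is removed by the lattice symmetry `tsum_ofReal_nobleXiIotaN_exch`).
[cite: FitznerVanDerHofstad2017, Prop. 5.6 (5.37) (arXiv:1506.07977v2 p. 53); §5.1 (p. 49); §3.5 (p. 30); Remark 2.3 (pp. 12–13); §5.4 (p. 56)] -/
theorem nobleXiIotaN_summable_and_tsum_le_of_chain (p : unitInterval) (ι₀ : Fin d × Bool) {m : Type*} [Fintype m]
    [DecidableEq m] {v y : m → ℝ≥0∞} {P Q : Matrix m m ℝ≥0∞} {uR wR : m → ℝ} {BR AR : Matrix m m ℝ}
    (hu0 : ∀ a, 0 ≤ uR a) (hw0 : ∀ b, 0 ≤ wR b) (hB0 : ∀ a b, 0 ≤ BR a b) (hA0 : ∀ a b, 0 ≤ AR a b)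
    (hu : ∀ a, v a ≤ ENNReal.ofReal (uR a)) (hw : ∀ b, y b ≤ ENNReal.ofReal (wR b))
    (hB : ∀ a b, P a b ≤ ENNReal.ofReal (BR a b)) (hA : ∀ a b, Q a b ≤ ENNReal.ofReal (AR a b)) (n : ℕ)
    (h : invTwoD d * ∑ ι : Fin d × Bool, ∑' x, nobleXiIotaT d p (stepVec ι) (n + 1) x ≤ v ᵥ* (P ^ n * Q) ⬝ᵥ y) :
    Summable (nobleXiIotaN d p (stepVec ι₀) (n + 1)) ∧
      ∑' x, nobleXiIotaN d p (stepVec ι₀) (n + 1) x ≤ uR ⬝ᵥ ((BR ^ n * AR) *ᵥ wR) := by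
  have hd : d ≠ 0 := Nat.pos_iff_ne_zero.1 ι₀.1.pos
  have h₁ := le_of_invTwoD_mul_sum_le hd (invTwoD_mul_sum_tsum_ofReal_le_of_T p (n + 1) h) ι₀
    fun ι => tsum_ofReal_nobleXiIotaN_exch p (n + 1) ι ι₀
  rw [← Matrix.vecMul_vecMul] at h₁
  exact summable_and_tsum_le_of_chain_majorants_ofReal (fun x => nobleXiIotaN_nonneg p _ _ x)
    hu0 hw0 hB0 hA0 hu hw hB hA n h₁

/-- **Literally the `hN` shape of `NobleNSums.NSumLE_rows_of_bounds` for `Ξ N = Ξ^{(N),ι₀}`.** Averaged chain bounds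
at every `n ≥ 3` and real majorants give
`∀ N, 4 ≤ N → Summable (nobleXiIotaN d p (e ι₀) N) ∧ Σ_x … ≤ uℝ ⬝ᵥ ((Bℝ^{N−1} * Aℝ) *ᵥ wℝ)`.
[cite: FitznerVanDerHofstad2017, Prop. 5.6 (5.37) (arXiv:1506.07977v2 p. 53); Remark 2.3 (pp. 12–13); §5.4 (p. 56)] -/
theorem nobleXiIotaN_hN_of_chain (p : unitInterval) (ι₀ : Fin d × Bool) {m : Type*} [Fintype m] [DecidableEq m]
    {v y : m → ℝ≥0∞} {P Q : Matrix m m ℝ≥0∞} {uR wR : m → ℝ} {BR AR : Matrix m m ℝ}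
    (hu0 : ∀ a, 0 ≤ uR a) (hw0 : ∀ b, 0 ≤ wR b) (hB0 : ∀ a b, 0 ≤ BR a b) (hA0 : ∀ a b, 0 ≤ AR a b)
    (hu : ∀ a, v a ≤ ENNReal.ofReal (uR a)) (hw : ∀ b, y b ≤ ENNReal.ofReal (wR b))
    (hB : ∀ a b, P a b ≤ ENNReal.ofReal (BR a b)) (hA : ∀ a b, Q a b ≤ ENNReal.ofReal (AR a b))
    (hchain : ∀ n, 3 ≤ n →
      invTwoD d * ∑ ι : Fin d × Bool, ∑' x, nobleXiIotaT d p (stepVec ι) (n + 1) x ≤ v ᵥ* (P ^ n * Q) ⬝ᵥ y) :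
    ∀ N, 4 ≤ N → Summable (nobleXiIotaN d p (stepVec ι₀) N) ∧
      ∑' x, nobleXiIotaN d p (stepVec ι₀) N x ≤ uR ⬝ᵥ ((BR ^ (N - 1) * AR) *ᵥ wR) := by
  intro N hN
  obtain ⟨n, rfl⟩ := Nat.exists_eq_add_of_le' (show 1 ≤ N by omega)
  rw [Nat.add_sub_cancel]
  exact nobleXiIotaN_summable_and_tsum_le_of_chain p ι₀ hu0 hw0 hB0 hA0 hu hw hB hA n (hchain n (by omega))

/-- The same from averaged chain bounds at every `n ≥ 1` (all of Prop. 5.6, `N ≥ 2`): every `N ≥ 2`.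
[cite: FitznerVanDerHofstad2017, Prop. 5.6 (5.37) (arXiv:1506.07977v2 p. 53); Remark 2.3 (pp. 12–13)] -/
theorem nobleXiIotaN_perN_of_chain (p : unitInterval) (ι₀ : Fin d × Bool) {m : Type*} [Fintype m] [DecidableEq m]
    {v y : m → ℝ≥0∞} {P Q : Matrix m m ℝ≥0∞} {uR wR : m → ℝ} {BR AR : Matrix m m ℝ}
    (hu0 : ∀ a, 0 ≤ uR a) (hw0 : ∀ b, 0 ≤ wR b) (hB0 : ∀ a b, 0 ≤ BR a b) (hA0 : ∀ a b, 0 ≤ AR a b)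
    (hu : ∀ a, v a ≤ ENNReal.ofReal (uR a)) (hw : ∀ b, y b ≤ ENNReal.ofReal (wR b))
    (hB : ∀ a b, P a b ≤ ENNReal.ofReal (BR a b)) (hA : ∀ a b, Q a b ≤ ENNReal.ofReal (AR a b))
    (hchain : ∀ n, 1 ≤ n →
      invTwoD d * ∑ ι : Fin d × Bool, ∑' x, nobleXiIotaT d p (stepVec ι) (n + 1) x ≤ v ᵥ* (P ^ n * Q) ⬝ᵥ y) :
    ∀ N, 2 ≤ N → Summable (nobleXiIotaN d p (stepVec ι₀) N) ∧
      ∑' x, nobleXiIotaN d p (stepVec ι₀) N x ≤ uR ⬝ᵥ ((BR ^ (N - 1) * AR) *ᵥ wR) := by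
  intro N hN
  obtain ⟨n, rfl⟩ := Nat.exists_eq_add_of_le' (show 1 ≤ N by omega)
  rw [Nat.add_sub_cancel]
  exact nobleXiIotaN_summable_and_tsum_le_of_chain p ι₀ hu0 hw0 hB0 hA0 hu hw hB hA n (hchain n (by omega))

end Literature.Probability.FitznerVanDerHofstad2017.NobleBlocks

end
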